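import Mathlib.NumberTheory.ArithmeticFunction.Misc
import Mathlib.NumberTheory.EulerProduct.Basic
import Literature.NumberTheory.Sieve.GoldbachSingularSeriesSum
import HarnessLib

/-!
# The mean value of the Goldbach singular series over the multiples of `q`
# (Montgomery 1971; Goldston–Suriajaya 2021, Lemma 1 — qualitative form, uniform in `q`)

Topic `Literature/NumberTheory/Sieve`. Everything in this file is PROVED.

Goldston–Suriajaya (arXiv:2104.09407), Lemma 1 (after Montgomery, *Topics in Multiplicative
Number Theory*, 1971): `G_q(x) := ∑_{k ≤ x} 𝔖(qk) = (q/φ(q)) x + O((q/φ(q)) log 2x)` uniformly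
for `q ≥ 1`, `x ≥ 1`, where `𝔖` is the Goldbach / prime-pair singular series
(`Literature.NumberTheory.Sieve.goldbachSingularSeries`: `𝔖(n) = 2C₂ ∏_{p ∣ n, p > 2} (p−1)/(p−2)` for even `n`, `0` for odd
`n`). We prove, by the argument of GS21 §6 (Montgomery's), the two consequences that the
Goldbach application (GS21 §3, (V_q=)) uses, in qualitative form but UNIFORMLY in `q`:

* `sum_goldbachSingularSeries_mul_le` — `G_q(K) ≤ (q/φ(q)) K` for all `q ≥ 1`, `K ≥ 0`;
* `sum_goldbachSingularSeries_mul_ge` — for every `η > 0` there is `K₀` such that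
  `G_q(K) ≥ (1 − η) (q/φ(q)) (K − 1)` for all `K ≥ K₀` and all `q ≥ 1`.

Proof (GS21 §6): `𝔖(qk) = 𝟙_{2 ∣ qk} 2C₂ H(q) H_q(k)` with `H(q) = ∏_{p ∣ q, p>2} (p−1)/(p−2)`,
`H_q(k) = ∏_{p ∣ k, p ∤ 2q} (p−1)/(p−2) = ∑_{d ∣ k} f_q(d)`,
`f_q(d) = μ²(d) 𝟙_{(d,2q)=1} ∏_{p ∣ d} 1/(p−2) ≥ 0`; hence
`∑_{k ≤ K} H_q(k) = ∑_{d ≤ K} f_q(d) ⌊K/d⌋ ∈ [K ∑_{d ≤ K} f_q(d)/d − ∑_{d ≤ K} f_q(d), K S_q]`,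
`S_q = ∑_d f_q(d)/d = ∏_{p ∤ 2q} (1 + 1/(p(p−2))) = q/((2,q) φ(q) C₂ H(q))` (Euler product against
`C₂ = ∏_{p>2}(1 − 1/(p−1)²)`), and the two error terms are `o(K)` uniformly in `q` because
`f_q ≤ f_1` and `∑_d f_1(d)/d < ∞` (no rate is needed, so Mertens' theorem is avoided).

## References

* D. A. Goldston, A. I. Suriajaya, *Note on the Goldbach conjecture and Landau–Siegel zeros*,
  arXiv:2104.09407 (2021), Lemma 1 and §6 (proof of Lemma 1). [cite: GoldstonSuriajaya2021, Lemma 1, §6]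
* H. L. Montgomery, *Topics in Multiplicative Number Theory*, Lecture Notes in Math. 227,
  Springer 1971 (the source of Lemma 1, as cited in GS21).
-/

noncomputable section

open scoped ArithmeticFunction.zeta ArithmeticFunction.Moebius Topology
open Finset ArithmeticFunction Filter

namespace Literature.NumberTheory.Sieve

namespace SingularSeriesMean

/-! ### The arithmetic functions `f_q`, `H_q` and the factor `H(q)` -/

/-- `H(n) = ∏_{p ∣ n, p > 2} (p − 1)/(p − 2)` (GS21 (H_q) with `q = 1`), so that
`𝔖(n) = 𝟙_{2 ∣ n} 2C₂ H(n)` for `n ≥ 1` (GS21 (SH)). [cite: GoldstonSuriajaya2021, §6 (H_q), (SH)] -/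
def hFactor (n : ℕ) : ℝ :=
  ∏ p ∈ n.primeFactors.filter (2 < ·), (((p : ℝ) - 1) / ((p : ℝ) - 2))

/-- `f_q(d) = μ²(d) 𝟙_{(d, 2q) = 1} ∏_{p ∣ d} 1/(p − 2)`, the coefficients of the divisor-sum
expansion `H_q(k) = ∑_{d ∣ k} f_q(d)` (GS21 §6, proof of (desired)), as a real arithmetic
function of `d`. [cite: GoldstonSuriajaya2021, §6 (proof of (desired))] -/
def fq (q : ℕ) : ArithmeticFunction ℝ :=
  ⟨fun d ↦ if Squarefree d ∧ Nat.Coprime d (2 * q) then ∏ p ∈ d.primeFactors, 1 / ((p : ℝ) - 2)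
    else 0, by simp⟩

/-- Unfolding lemma for `fq`. [folklore] -/
theorem fq_apply (q d : ℕ) :
    fq q d = if Squarefree d ∧ Nat.Coprime d (2 * q) then ∏ p ∈ d.primeFactors, 1 / ((p : ℝ) - 2)
      else 0 := rfl

/-- `H_q = f_q * ζ`, i.e. `H_q(k) = ∑_{d ∣ k} f_q(d)`; for `k ≥ 1` this is
`∏_{p ∣ k, p > 2, p ∤ q} (p − 1)/(p − 2)` (`Hq_apply`, GS21 (H_q)). [cite: GoldstonSuriajaya2021, §6 (H_q)] -/
def Hq (q : ℕ) : ArithmeticFunction ℝ := fq q * ζ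

/-- `f_q ≥ 0`. [folklore] -/
theorem fq_nonneg (q d : ℕ) : 0 ≤ fq q d := by
  rw [fq_apply]
  split_ifs with h
  · refine prod_nonneg fun p hp ↦ ?_
    have hp' := Nat.mem_primeFactors.1 hp
    have hp2 : p ≠ 2 := by
      rintro rfl
      have h2 : (2 : ℕ) ∣ Nat.gcd d (2 * q) := Nat.dvd_gcd hp'.2.1 (dvd_mul_right 2 q)
      rw [h.2] at h2
      exact absurd h2 (by norm_num)
    have hp3 : (3 : ℝ) ≤ p := by exact_mod_cast lt_of_le_of_ne hp'.1.two_le (Ne.symm hp2)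
    exact div_nonneg zero_le_one (by linarith)
  · exact le_rfl

/-- `f_q(d) = 0` unless `d` is squarefree. [folklore] -/
theorem fq_eq_zero_of_not_squarefree (q : ℕ) {d : ℕ} (hd : ¬Squarefree d) : fq q d = 0 := by
  rw [fq_apply, if_neg (fun h ↦ hd h.1)]

/-- `f_q` is multiplicative. [folklore] -/
theorem isMultiplicative_fq (q : ℕ) : (fq q).IsMultiplicative := by
  refine ⟨?_, fun {m n} hmn ↦ ?_⟩
  · rw [fq_apply, if_pos ⟨squarefree_one, Nat.coprime_one_left _⟩, Nat.primeFactors_one,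
      prod_empty]
  · rcases eq_or_ne m 0 with rfl | hm
    · simp
    rcases eq_or_ne n 0 with rfl | hn
    · simp
    rw [fq_apply, fq_apply, fq_apply]
    by_cases h : Squarefree (m * n) ∧ Nat.Coprime (m * n) (2 * q)
    · have hsq := (Nat.squarefree_mul hmn).1 h.1
      have hco := Nat.coprime_mul_iff_left.1 h.2
      rw [if_pos h, if_pos ⟨hsq.1, hco.1⟩, if_pos ⟨hsq.2, hco.2⟩, Nat.primeFactors_mul hm hn,
        prod_union hmn.disjoint_primeFactors]
    · rw [if_neg h]
      by_cases hm' : Squarefree m ∧ Nat.Coprime m (2 * q)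
      · by_cases hn' : Squarefree n ∧ Nat.Coprime n (2 * q)
        · exact absurd ⟨(Nat.squarefree_mul hmn).2 ⟨hm'.1, hn'.1⟩,
            Nat.coprime_mul_iff_left.2 ⟨hm'.2, hn'.2⟩⟩ h
        · rw [if_neg hn', mul_zero]
      · rw [if_neg hm', zero_mul]

/-- `H_q` is multiplicative. [folklore] -/
theorem isMultiplicative_Hq (q : ℕ) : (Hq q).IsMultiplicative :=
  (isMultiplicative_fq q).mul isMultiplicative_zeta.natCast

/-- `f_q(p) = 1/(p − 2)` for a prime `p ∤ 2q`, and `0` for `p ∣ 2q`. [folklore] -/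
theorem fq_prime (q : ℕ) {p : ℕ} (hp : p.Prime) :
    fq q p = if Nat.Coprime p (2 * q) then 1 / ((p : ℝ) - 2) else 0 := by
  rw [fq_apply, hp.primeFactors, prod_singleton]
  by_cases h : Nat.Coprime p (2 * q)
  · rw [if_pos ⟨hp.squarefree, h⟩, if_pos h]
  · rw [if_neg (fun h' ↦ h h'.2), if_neg h]

/-- `f_q(p^i) = 0` for `i ≥ 2`. [folklore] -/
theorem fq_prime_pow (q : ℕ) {p : ℕ} (hp : p.Prime) {i : ℕ} (hi : 2 ≤ i) : fq q (p ^ i) = 0 := by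
  refine fq_eq_zero_of_not_squarefree q fun h ↦ ?_
  have := (Nat.squarefree_pow_iff hp.ne_one (by omega)).1 h
  omega

/-- `H_q(p^i) = 1 + f_q(p)` for `i ≥ 1`. [folklore] -/
theorem Hq_prime_pow (q : ℕ) {p : ℕ} (hp : p.Prime) {i : ℕ} (hi : 1 ≤ i) :
    Hq q (p ^ i) = 1 + fq q p := by
  rw [Hq, coe_mul_zeta_apply, Nat.divisors_prime_pow hp, Finset.sum_map]
  simp only [Function.Embedding.coeFn_mk]
  obtain ⟨j, rfl⟩ : ∃ j, i = j + 1 := ⟨i - 1, by omega⟩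
  rw [Finset.sum_range_succ', pow_zero, (isMultiplicative_fq q).map_one, add_comm]
  congr 1
  rw [Finset.sum_range_succ', zero_add, pow_one]
  rw [Finset.sum_eq_zero (fun k _ ↦ fq_prime_pow q hp (by omega)), zero_add]

/-- **GS21 (H_q)**: for `k ≥ 1`, `H_q(k) = ∏_{p ∣ k, p > 2, p ∤ q} (p − 1)/(p − 2)`.
[cite: GoldstonSuriajaya2021, §6 (H_q)] -/
theorem Hq_apply (q : ℕ) {k : ℕ} (hk : k ≠ 0) :
    Hq q k = ∏ p ∈ k.primeFactors.filter (fun p ↦ 2 < p ∧ ¬p ∣ q),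
      (((p : ℝ) - 1) / ((p : ℝ) - 2)) := by
  -- the right-hand side as a multiplicative arithmetic function
  set G : ArithmeticFunction ℝ := ⟨fun k ↦ if k = 0 then 0 else
    ∏ p ∈ k.primeFactors.filter (fun p ↦ 2 < p ∧ ¬p ∣ q), (((p : ℝ) - 1) / ((p : ℝ) - 2)),
    by simp⟩ with hGdef
  have hG : ∀ k, k ≠ 0 → G k = ∏ p ∈ k.primeFactors.filter (fun p ↦ 2 < p ∧ ¬p ∣ q),
      (((p : ℝ) - 1) / ((p : ℝ) - 2)) := fun k hk ↦ by
    simp only [hGdef, ArithmeticFunction.coe_mk, if_neg hk]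
  have hGmul : G.IsMultiplicative := by
    refine ⟨by rw [hG 1 one_ne_zero, Nat.primeFactors_one, filter_empty, prod_empty], ?_⟩
    intro m n hmn
    rcases eq_or_ne m 0 with rfl | hm
    · simp
    rcases eq_or_ne n 0 with rfl | hn
    · simp
    rw [hG _ (mul_ne_zero hm hn), hG m hm, hG n hn, Nat.primeFactors_mul hm hn, filter_union,
      prod_union (disjoint_filter_filter hmn.disjoint_primeFactors)]
  suffices Hq q = G by rw [this, hG k hk]
  refine (IsMultiplicative.eq_iff_eq_on_prime_powers _ (isMultiplicative_Hq q) _ hGmul).2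
    fun p i hp ↦ ?_
  rcases Nat.eq_zero_or_pos i with rfl | hi
  · rw [pow_zero, (isMultiplicative_Hq q).map_one, hGmul.map_one]
  rw [Hq_prime_pow q hp hi, hG _ (pow_ne_zero _ hp.ne_zero), Nat.primeFactors_prime_pow hi.ne' hp,
    filter_singleton, fq_prime q hp]
  have hp2 : (2 : ℝ) ≤ p := by exact_mod_cast hp.two_le
  by_cases hc : Nat.Coprime p (2 * q)
  · have hodd : p ≠ 2 := by
      rintro rfl
      exact absurd (Nat.Coprime.coprime_mul_right_right hc) (by norm_num)
    have hpq : ¬p ∣ q := fun h ↦ by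
      have := Nat.Coprime.coprime_mul_left_right hc
      exact hp.ne_one (Nat.Coprime.eq_one_of_dvd this h)
    have h2p : 2 < p := lt_of_le_of_ne hp.two_le (Ne.symm hodd)
    rw [if_pos hc, if_pos ⟨h2p, hpq⟩, prod_singleton]
    have : (p : ℝ) - 2 ≠ 0 := by
      have : (3 : ℝ) ≤ p := by exact_mod_cast h2p
      linarith
    field_simp
    ring
  · rw [if_neg hc, add_zero]
    have : ¬(2 < p ∧ ¬p ∣ q) := by
      rintro ⟨h2p, hpq⟩
      apply hc
      rw [Nat.coprime_mul_iff_right]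
      exact ⟨(Nat.coprime_primes hp Nat.prime_two).2 (by omega),
        (Nat.Prime.coprime_iff_not_dvd hp).2 hpq⟩
    rw [if_neg this, prod_empty]

/-! ### `𝔖(qk) = 𝟙_{2 ∣ qk} · 2C₂ · H(q) · H_q(k)` -/

/-- `H_q(2j) = H_q(j)` (the prime `2` does not enter `H_q`). [cite: GoldstonSuriajaya2021, §6 (before (G_qformula))] -/
theorem Hq_two_mul (q : ℕ) {j : ℕ} (hj : j ≠ 0) : Hq q (2 * j) = Hq q j := by
  rw [Hq_apply q (mul_ne_zero two_ne_zero hj), Hq_apply q hj, Nat.primeFactors_mul two_ne_zero hj,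
    Nat.prime_two.primeFactors, filter_union, filter_singleton, if_neg (by norm_num), empty_union]

/-- **GS21 (SH), (Hmult)**: for `q, k ≥ 1`, `𝔖(qk) = 𝟙_{2 ∣ qk} 2C₂ H(q) H_q(k)`.
[cite: GoldstonSuriajaya2021, §6 (SH), (Hmult)] -/
theorem goldbachSingularSeries_mul {q k : ℕ} (hq : q ≠ 0) (hk : k ≠ 0) :
    goldbachSingularSeries (q * k) =
      if Even (q * k) then 2 * twinPrimeConst * hFactor q * Hq q k else 0 := by
  rw [goldbachSingularSeries]
  by_cases he : Even (q * k)
  · rw [if_neg (Nat.not_odd_iff_even.2 he), if_pos he, hFactor, Hq_apply q hk,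
      mul_assoc (2 * twinPrimeConst)]
    congr 1
    rw [Nat.primeFactors_mul hq hk, filter_union]
    -- split the prime factors of `k` according to `p ∣ q`
    have hsplit : (k.primeFactors.filter (2 < ·)) =
        (k.primeFactors.filter (fun p ↦ 2 < p ∧ p ∣ q)) ∪
          (k.primeFactors.filter (fun p ↦ 2 < p ∧ ¬p ∣ q)) := by
      rw [← filter_or]
      refine filter_congr fun p _ ↦ ?_
      tauto
    have hsub : k.primeFactors.filter (fun p ↦ 2 < p ∧ p ∣ q) ⊆ q.primeFactors.filter (2 < ·) := by
      intro p hp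
      rw [mem_filter, Nat.mem_primeFactors] at hp ⊢
      exact ⟨⟨hp.1.1, hp.2.2, hq⟩, hp.2.1⟩
    rw [hsplit, ← union_assoc, union_eq_left.2 hsub, prod_union]
    rw [disjoint_left]
    intro p hp hp'
    rw [mem_filter, Nat.mem_primeFactors] at hp hp'
    exact hp'.2.2 hp.1.2.1
  · rw [if_pos (Nat.not_even_iff_odd.1 he), if_neg he]

/-- `H(q) ≥ 1` hence `> 0`. [folklore] -/
theorem one_le_hFactor (q : ℕ) : 1 ≤ hFactor q := by
  refine Finset.one_le_prod fun p hp ↦ ?_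
  have hp3 : (3 : ℝ) ≤ p := by exact_mod_cast (mem_filter.1 hp).2
  rw [le_div_iff₀ (by linarith)]
  linarith

/-! ### The series `S_q = ∑_d f_q(d)/d` -/

/-- `g_q(d) = f_q(d)/d`, as an arithmetic function. [folklore] -/
def gq (q : ℕ) : ArithmeticFunction ℝ :=
  ⟨fun d ↦ fq q d / d, by simp⟩

/-- Unfolding lemma for `gq`. [folklore] -/
theorem gq_apply (q d : ℕ) : gq q d = fq q d / d := rfl

/-- `g_q ≥ 0`. [folklore] -/
theorem gq_nonneg (q d : ℕ) : 0 ≤ gq q d := div_nonneg (fq_nonneg q d) (Nat.cast_nonneg d)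

/-- `g_q` is multiplicative. [folklore] -/
theorem isMultiplicative_gq (q : ℕ) : (gq q).IsMultiplicative := by
  refine ⟨by rw [gq_apply, (isMultiplicative_fq q).map_one, Nat.cast_one, div_one], ?_⟩
  intro m n hmn
  rw [gq_apply, gq_apply, gq_apply, (isMultiplicative_fq q).map_mul_of_coprime hmn, Nat.cast_mul]
  rcases eq_or_ne m 0 with rfl | hm
  · simp
  rcases eq_or_ne n 0 with rfl | hn
  · simp
  field_simp

/-- `g_q(d) = 0` unless `d` is squarefree. [folklore] -/
theorem gq_eq_zero_of_not_squarefree (q : ℕ) {d : ℕ} (hd : ¬Squarefree d) : gq q d = 0 := by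
  rw [gq_apply, fq_eq_zero_of_not_squarefree q hd, zero_div]

/-- `f_q ≤ f_1` pointwise (the coprimality condition only shrinks the support). [folklore] -/
theorem fq_le_fq_one (q d : ℕ) : fq q d ≤ fq 1 d := by
  rw [fq_apply, fq_apply]
  by_cases h : Squarefree d ∧ Nat.Coprime d (2 * q)
  · have h1 : Squarefree d ∧ Nat.Coprime d (2 * 1) :=
      ⟨h.1, by rw [mul_one]; exact Nat.Coprime.coprime_mul_right_right h.2⟩
    rw [if_pos h, if_pos h1]
  · rw [if_neg h]
    have := fq_nonneg 1 d
    rwa [fq_apply] at this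

/-- `g_q ≤ g_1` pointwise. [folklore] -/
theorem gq_le_gq_one (q d : ℕ) : gq q d ≤ gq 1 d :=
  div_le_div_of_nonneg_right (fq_le_fq_one q d) (Nat.cast_nonneg d)

/-- `g_q(p) ≤ 3/p²` at primes (`1/(p(p−2)) ≤ 3/p²` for `p ≥ 3`; `g_q(2) = 0`). [folklore] -/
theorem gq_prime_le (q : ℕ) {p : ℕ} (hp : p.Prime) : gq q p ≤ 3 / (p : ℝ) ^ 2 := by
  rw [gq_apply, fq_prime q hp]
  have hp2 : (2 : ℝ) ≤ p := by exact_mod_cast hp.two_le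
  have hp0 : (0 : ℝ) < p := by linarith
  split_ifs with hc
  · have hodd : p ≠ 2 := by
      rintro rfl
      exact absurd (Nat.Coprime.coprime_mul_right_right hc) (by norm_num)
    have hp3 : (3 : ℝ) ≤ p := by exact_mod_cast lt_of_le_of_ne hp.two_le (Ne.symm hodd)
    rw [div_div, div_le_div_iff₀ (by nlinarith) (by positivity)]
    nlinarith
  · rw [zero_div]; positivity

/-- The partial Euler products of `g_q` are bounded: `∏_{p < N} (1 + g_q(p)) ≤ exp(∑_n 3/n²)`.
[folklore] -/
theorem prod_primesBelow_gq_le (q N : ℕ) :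
    ∏ p ∈ N.primesBelow, (1 + gq q p) ≤ Real.exp (∑' n : ℕ, 3 / (n : ℝ) ^ 2) := by
  have hsum : Summable fun n : ℕ ↦ 3 / (n : ℝ) ^ 2 :=
    ((Real.summable_nat_pow_inv.2 one_lt_two).mul_left 3).congr fun n ↦ (div_eq_mul_inv _ _).symm
  calc ∏ p ∈ N.primesBelow, (1 + gq q p) ≤ ∏ p ∈ N.primesBelow, Real.exp (gq q p) :=
        prod_le_prod (fun p _ ↦ by linarith [gq_nonneg q p]) fun p _ ↦ by
          linarith [Real.add_one_le_exp (gq q p)]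
    _ = Real.exp (∑ p ∈ N.primesBelow, gq q p) := (Real.exp_sum _ _).symm
    _ ≤ Real.exp (∑' n : ℕ, 3 / (n : ℝ) ^ 2) := by
        refine Real.exp_le_exp.2 ?_
        calc ∑ p ∈ N.primesBelow, gq q p ≤ ∑ p ∈ N.primesBelow, 3 / (p : ℝ) ^ 2 :=
              sum_le_sum fun p hp ↦ gq_prime_le q (Nat.mem_primesBelow.1 hp).2
          _ ≤ ∑' n : ℕ, 3 / (n : ℝ) ^ 2 :=
              hsum.sum_le_tsum _ fun n _ ↦ by positivity

/-- `g_q` is summable and `S_q = ∑_d g_q(d) ≤ exp(∑_n 3/n²)`. [cite: GoldstonSuriajaya2021, §6 (proof of (desired))] -/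
theorem summable_gq (q : ℕ) : Summable (fun d ↦ gq q d) :=
  (GoldbachSeries.summable_of_prod_primesBelow_le (isMultiplicative_gq q) (gq_nonneg q)
    (fun _ hd ↦ gq_eq_zero_of_not_squarefree q hd) (prod_primesBelow_gq_le q)).1

/-- `S_q := ∑_{d ≥ 1} f_q(d)/d` (`= ∏_{p ∤ 2q}(1 + 1/(p(p−2))) = q/((2,q)φ(q)C₂H(q))`, GS21 §6).
[cite: GoldstonSuriajaya2021, §6 (proof of (desired))] -/
def sq (q : ℕ) : ℝ := ∑' d : ℕ, gq q d

/-- `1 ≤ S_q` (the term `d = 1`). [folklore] -/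
theorem one_le_sq (q : ℕ) : 1 ≤ sq q := by
  have h1 : gq q 1 = 1 := (isMultiplicative_gq q).map_one
  rw [sq, ← h1]
  exact (summable_gq q).le_tsum 1 fun j _ ↦ gq_nonneg q j

/-- `S_q ≤ S_1`. [folklore] -/
theorem sq_le_sq_one (q : ℕ) : sq q ≤ sq 1 :=
  (summable_gq q).tsum_le_tsum (gq_le_gq_one q) (summable_gq 1)

/-! ### The Euler product: `C₂ H(q) S_q = ∏_{p ∣ q, p > 2} p/(p−1)` -/

/-- The local factor: `∑_e g_q(p^e) = 1 + g_q(p)`. [folklore] -/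
theorem tsum_gq_prime_pow (q : ℕ) {p : ℕ} (hp : p.Prime) :
    ∑' e : ℕ, gq q (p ^ e) = 1 + gq q p := by
  rw [tsum_eq_sum (s := {0, 1})]
  · rw [sum_pair (by norm_num), pow_zero, pow_one, (isMultiplicative_gq q).map_one]
  · intro e he
    simp only [mem_insert, mem_singleton, not_or] at he
    exact gq_eq_zero_of_not_squarefree q fun h ↦ by
      have := (Nat.squarefree_pow_iff hp.ne_one (by omega)).1 h
      omega

/-- The partial Euler products of `g_q` converge to `S_q`. [folklore] -/
theorem tendsto_prod_primesBelow_gq (q : ℕ) :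
    Tendsto (fun N : ℕ ↦ ∏ p ∈ N.primesBelow, (1 + gq q p)) atTop (𝓝 (sq q)) := by
  have hnorm : Summable fun d ↦ ‖gq q d‖ :=
    (summable_gq q).congr fun d ↦ (Real.norm_of_nonneg (gq_nonneg q d)).symm
  have E := (isMultiplicative_gq q).eulerProduct hnorm
  refine E.congr' (Eventually.of_forall fun n ↦ prod_congr rfl fun p hp ↦ ?_)
  exact tsum_gq_prime_pow q (Nat.mem_primesBelow.mp hp).2

/-- For `N > q ≥ 1`: `(∏_{p < N} (1 + g_q(p))) · ∏_{2 < p < N} (1 − 1/(p−1)²) = ∏_{p ∣ q, p>2} (1 − 1/(p−1)²)`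
(the factors at `p ∤ q` cancel: `(1 + 1/(p(p−2)))(1 − 1/(p−1)²) = 1`). [cite: GoldstonSuriajaya2021, §6 (proof of (desired))] -/
theorem prod_primesBelow_gq_mul_twinPrimeConstPartial {q N : ℕ} (hq : q ≠ 0) (hN : q < N) :
    (∏ p ∈ N.primesBelow, (1 + gq q p)) * twinPrimeConstPartial (N - 1) =
      ∏ p ∈ q.primeFactors.filter (2 < ·), (1 - 1 / ((p : ℝ) - 1) ^ 2) := by
  have hN1 : N - 1 + 1 = N := by omega
  rw [twinPrimeConstPartial, Nat.primesLE, hN1]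
  -- write the first product over the primes `2 < p < N` as well
  have h1 : ∏ p ∈ N.primesBelow, (1 + gq q p) = ∏ p ∈ N.primesBelow.filter (2 < ·), (1 + gq q p) := by
    rw [prod_filter]
    refine prod_congr rfl fun p hp ↦ ?_
    have hpp := (Nat.mem_primesBelow.1 hp).2
    split_ifs with h2
    · rfl
    · have : p = 2 := le_antisymm (not_lt.1 h2) hpp.two_le
      subst this
      rw [gq_apply, fq_prime q Nat.prime_two, if_neg (by norm_num), zero_div, add_zero]
  rw [h1, ← prod_mul_distrib]
  set T := N.primesBelow.filter (2 < ·) with hT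
  rw [← prod_filter_mul_prod_filter_not T (fun p ↦ p ∣ q)]
  have hA : T.filter (fun p ↦ p ∣ q) = q.primeFactors.filter (2 < ·) := by
    ext p
    simp only [hT, mem_filter, Nat.mem_primesBelow, Nat.mem_primeFactors]
    constructor
    · rintro ⟨⟨⟨_, hp⟩, hp2⟩, hpq⟩
      exact ⟨⟨hp, hpq, hq⟩, hp2⟩
    · rintro ⟨⟨hp, hpq, _⟩, hp2⟩
      exact ⟨⟨⟨lt_of_le_of_lt (Nat.le_of_dvd (Nat.pos_of_ne_zero hq) hpq) hN, hp⟩, hp2⟩, hpq⟩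
  have hB : ∏ p ∈ T.filter (fun p ↦ ¬p ∣ q), (1 + gq q p) * (1 - 1 / ((p : ℝ) - 1) ^ 2) = 1 := by
    refine prod_eq_one fun p hp ↦ ?_
    simp only [hT, mem_filter, Nat.mem_primesBelow] at hp
    obtain ⟨⟨⟨_, hpp⟩, hp2⟩, hpq⟩ := hp
    have hc : Nat.Coprime p (2 * q) := by
      rw [Nat.coprime_mul_iff_right]
      exact ⟨(Nat.coprime_primes hpp Nat.prime_two).2 (by omega), (Nat.Prime.coprime_iff_not_dvd hpp).2 hpq⟩
    rw [gq_apply, fq_prime q hpp, if_pos hc]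
    have hp3 : (3 : ℝ) ≤ p := by exact_mod_cast hp2
    have h1' : (p : ℝ) - 1 ≠ 0 := by linarith
    have h2' : (p : ℝ) - 2 ≠ 0 := by linarith
    have h0' : (p : ℝ) ≠ 0 := by linarith
    field_simp
    ring
  rw [hB, mul_one, hA]
  refine prod_congr rfl fun p hp ↦ ?_
  simp only [mem_filter, Nat.mem_primeFactors] at hp
  obtain ⟨⟨hpp, hpq, _⟩, hp2⟩ := hp
  have hc : ¬Nat.Coprime p (2 * q) := fun h ↦
    hpp.ne_one (Nat.Coprime.eq_one_of_dvd (Nat.Coprime.coprime_mul_left_right h) hpq)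
  rw [gq_apply, fq_prime q hpp, if_neg hc, zero_div, add_zero, one_mul]

/-- **The value of the Euler product** (GS21 §6, display after (last)):
`C₂ · S_q = ∏_{p ∣ q, p > 2} (1 − 1/(p−1)²)`, i.e. `S_q = (1/C₂) ∏_{p ∣ q, p>2} p(p−2)/(p−1)²`.
[cite: GoldstonSuriajaya2021, §6 (proof of (desired))] -/
theorem twinPrimeConst_mul_sq {q : ℕ} (hq : q ≠ 0) :
    twinPrimeConst * sq q = ∏ p ∈ q.primeFactors.filter (2 < ·), (1 - 1 / ((p : ℝ) - 1) ^ 2) := by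
  have T1 : Tendsto (fun N : ℕ ↦ (∏ p ∈ N.primesBelow, (1 + gq q p)) * twinPrimeConstPartial (N - 1))
      atTop (𝓝 (sq q * twinPrimeConst)) :=
    (tendsto_prod_primesBelow_gq q).mul
      (tendsto_twinPrimeConstPartial_holds.comp (tendsto_sub_atTop_nat 1))
  have T2 : Tendsto (fun N : ℕ ↦ (∏ p ∈ N.primesBelow, (1 + gq q p)) * twinPrimeConstPartial (N - 1))
      atTop (𝓝 (∏ p ∈ q.primeFactors.filter (2 < ·), (1 - 1 / ((p : ℝ) - 1) ^ 2))) := by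
    refine tendsto_const_nhds.congr' ?_
    rw [EventuallyEq, eventually_atTop]
    exact ⟨q + 1, fun N hN ↦ (prod_primesBelow_gq_mul_twinPrimeConstPartial hq (by omega)).symm⟩
  rw [mul_comm]
  exact tendsto_nhds_unique T1 T2

/-- `q/φ(q) = ∏_{p ∣ q} p/(p − 1)` (Euler's product for `φ`), over `ℝ`. [folklore] -/
theorem cast_div_totient (q : ℕ) (hq : q ≠ 0) :
    (q : ℝ) / (Nat.totient q : ℝ) = ∏ p ∈ q.primeFactors, ((p : ℝ) / ((p : ℝ) - 1)) := by
  have h := Nat.totient_mul_prod_primeFactors q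
  have hφ : (0 : ℝ) < Nat.totient q := by exact_mod_cast Nat.totient_pos.2 (Nat.pos_of_ne_zero hq)
  have hcast : ((∏ p ∈ q.primeFactors, (p - 1) : ℕ) : ℝ) = ∏ p ∈ q.primeFactors, ((p : ℝ) - 1) := by
    rw [Nat.cast_prod]
    refine prod_congr rfl fun p hp ↦ ?_
    rw [Nat.cast_sub (Nat.prime_of_mem_primeFactors hp).one_le, Nat.cast_one]
  have hpos : ∀ p ∈ q.primeFactors, (0 : ℝ) < (p : ℝ) - 1 := fun p hp ↦ by
    have : (2 : ℝ) ≤ p := by exact_mod_cast (Nat.prime_of_mem_primeFactors hp).two_le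
    linarith
  have hprod : (0 : ℝ) < ∏ p ∈ q.primeFactors, ((p : ℝ) - 1) := prod_pos hpos
  have h' : (Nat.totient q : ℝ) * ∏ p ∈ q.primeFactors, (p : ℝ) = q * ∏ p ∈ q.primeFactors, ((p : ℝ) - 1) := by
    have := congrArg (fun n : ℕ ↦ (n : ℝ)) h
    simp only [Nat.cast_mul, Nat.cast_prod] at this
    rw [this, ← hcast, Nat.cast_prod]
  rw [prod_div_distrib, div_eq_div_iff hφ.ne' hprod.ne']
  linarith [h']

/-- **GS21 §6, main term of (desired)**: for `q ≥ 1`,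
`2C₂ H(q) S_q = (q/φ(q)) · (1 if q is even, 2 if q is odd)`, i.e. `S_q = q/((2,q) φ(q) C₂ H(q))`.
[cite: GoldstonSuriajaya2021, §6 (desired)] -/
theorem two_mul_twinPrimeConst_mul_hFactor_mul_sq {q : ℕ} (hq : q ≠ 0) :
    2 * twinPrimeConst * hFactor q * sq q =
      (q : ℝ) / (Nat.totient q : ℝ) * (if Even q then 1 else 2) := by
  have key : twinPrimeConst * hFactor q * sq q = ∏ p ∈ q.primeFactors.filter (2 < ·), ((p : ℝ) / ((p : ℝ) - 1)) := by
    rw [mul_right_comm, twinPrimeConst_mul_sq hq, hFactor, ← prod_mul_distrib]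
    refine prod_congr rfl fun p hp ↦ ?_
    have hp3 : (3 : ℝ) ≤ p := by exact_mod_cast (mem_filter.1 hp).2
    have h1 : (p : ℝ) - 1 ≠ 0 := by linarith
    have h2 : (p : ℝ) - 2 ≠ 0 := by linarith
    field_simp
    ring
  rw [cast_div_totient q hq, show 2 * twinPrimeConst * hFactor q * sq q =
    2 * (twinPrimeConst * hFactor q * sq q) by ring, key]
  rw [← prod_filter_mul_prod_filter_not q.primeFactors (2 < ·)]
  by_cases he : Even q
  · rw [if_pos he, mul_one]
    have h2 : q.primeFactors.filter (fun p ↦ ¬ 2 < p) = {2} := by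
      ext p
      simp only [mem_filter, Nat.mem_primeFactors, mem_singleton]
      constructor
      · rintro ⟨⟨hp, _, _⟩, h2⟩
        exact le_antisymm (not_lt.1 h2) hp.two_le
      · rintro rfl
        exact ⟨⟨Nat.prime_two, even_iff_two_dvd.1 he, hq⟩, by norm_num⟩
    rw [h2, prod_singleton]
    norm_num
    ring
  · rw [if_neg he]
    have h2 : q.primeFactors.filter (fun p ↦ ¬ 2 < p) = ∅ := by
      rw [Finset.filter_eq_empty_iff]
      intro p hp h2p
      have hpp := Nat.prime_of_mem_primeFactors hp
      have hp2 : p = 2 := le_antisymm (not_lt.1 h2p) hpp.two_le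
      subst hp2
      exact h2p (False.elim (he (even_iff_two_dvd.2 (Nat.dvd_of_mem_primeFactors hp))))
    rw [h2, prod_empty, mul_one, mul_comm]

/-! ### The mean value of `H_q` (GS21 (last), qualitative, uniform in `q`) -/

/-- `∑_{d ∈ (0, n]} g(d) = ∑_{d < n+1} g(d)` for an arithmetic function (`g(0) = 0`). [folklore] -/
theorem sum_Ioc_zero_eq_sum_range (g : ArithmeticFunction ℝ) (n : ℕ) :
    ∑ d ∈ Ioc 0 n, g d = ∑ d ∈ range (n + 1), g d := by
  have h : range (n + 1) = insert 0 (Ioc 0 n) := by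
    ext d
    simp only [mem_range, mem_insert, mem_Ioc]
    omega
  rw [h, sum_insert (by simp), g.map_zero, zero_add]

/-- The tail `T(m) = ∑_{i ≥ 0} g_1(i + m)` of `S_1`. [folklore] -/
def tail (m : ℕ) : ℝ := ∑' i : ℕ, gq 1 (i + m)

/-- `T(m) → 0`. [folklore] -/
theorem tendsto_tail : Tendsto tail atTop (𝓝 0) := tendsto_sum_nat_add fun d ↦ gq 1 d

/-- `0 ≤ T(m)`. [folklore] -/
theorem tail_nonneg (m : ℕ) : 0 ≤ tail m := tsum_nonneg fun _ ↦ gq_nonneg 1 _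

/-- `∑_{d ≤ n} g_q(d) ≥ S_q − T(n+1)`. [folklore] -/
theorem sq_sub_tail_le_sum (q n : ℕ) : sq q - tail (n + 1) ≤ ∑ d ∈ Ioc 0 n, gq q d := by
  rw [sum_Ioc_zero_eq_sum_range, sq, ← (summable_gq q).sum_add_tsum_nat_add (n + 1)]
  have : ∑' i : ℕ, gq q (i + (n + 1)) ≤ tail (n + 1) :=
    ((summable_nat_add_iff (n + 1)).2 (summable_gq q)).tsum_le_tsum (fun i ↦ gq_le_gq_one q _)
      ((summable_nat_add_iff (n + 1)).2 (summable_gq 1))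
  linarith

/-- `∑_{d ≤ n} g_q(d) ≤ S_q`. [folklore] -/
theorem sum_gq_le_sq (q n : ℕ) : ∑ d ∈ Ioc 0 n, gq q d ≤ sq q :=
  (summable_gq q).sum_le_tsum _ fun d _ ↦ gq_nonneg q d

/-- `∑_{y < d ≤ K} g_1(d) ≤ T(y+1)`. [folklore] -/
theorem sum_Ioc_gq_one_le_tail {y K : ℕ} (hyK : y ≤ K) : ∑ d ∈ Ioc y K, gq 1 d ≤ tail (y + 1) := by
  have h := sum_Ioc_consecutive (fun d ↦ gq 1 d) (Nat.zero_le y) hyK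
  have h1 := sum_gq_le_sq 1 K
  have h2 : ∑ d ∈ Ioc 0 y, gq 1 d + tail (y + 1) = sq 1 := by
    rw [sum_Ioc_zero_eq_sum_range, tail, sq]
    exact (summable_gq 1).sum_add_tsum_nat_add (y + 1)
  linarith

/-- **Upper bound** (GS21 (last), main term only): `∑_{k ≤ K} H_q(k) ≤ K S_q` for all `q`, `K`.
[cite: GoldstonSuriajaya2021, §6 (last)] -/
theorem sum_Hq_le (q K : ℕ) : ∑ k ∈ Ioc 0 K, Hq q k ≤ K * sq q := by
  rw [Hq, sum_Ioc_mul_zeta_eq_sum]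
  calc ∑ d ∈ Ioc 0 K, fq q d * ((K / d : ℕ) : ℝ)
      ≤ ∑ d ∈ Ioc 0 K, fq q d * ((K : ℝ) / d) :=
        sum_le_sum fun d _ ↦ mul_le_mul_of_nonneg_left Nat.cast_div_le (fq_nonneg q d)
    _ = K * ∑ d ∈ Ioc 0 K, gq q d := by
        rw [mul_sum]
        refine sum_congr rfl fun d _ ↦ ?_
        rw [gq_apply]
        ring
    _ ≤ K * sq q := mul_le_mul_of_nonneg_left (sum_gq_le_sq q K) (Nat.cast_nonneg K)

/-- **Lower bound with explicit errors**: for `y ≤ K`,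
`∑_{k ≤ K} H_q(k) ≥ K (S_q − T(K+1)) − y S_1 − K T(y+1)`
(from `⌊K/d⌋ ≥ K/d − 1`, `f_q ≤ f_1 = d g_1(d)`). [cite: GoldstonSuriajaya2021, §6 (last)] -/
theorem sum_Hq_ge_explicit (q : ℕ) {y K : ℕ} (hyK : y ≤ K) :
    K * (sq q - tail (K + 1)) - y * sq 1 - K * tail (y + 1) ≤ ∑ k ∈ Ioc 0 K, Hq q k := by
  rw [Hq, sum_Ioc_mul_zeta_eq_sum]
  -- termwise: `f_q(d) ⌊K/d⌋ ≥ K g_q(d) − f_1(d)`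
  have hterm : ∀ d ∈ Ioc 0 K, (K : ℝ) * gq q d - fq 1 d ≤ fq q d * ((K / d : ℕ) : ℝ) := by
    intro d hd
    have hd0 : 0 < d := (mem_Ioc.1 hd).1
    have hd0' : (0 : ℝ) < d := by exact_mod_cast hd0
    have hfloor : (K : ℝ) / d - 1 ≤ ((K / d : ℕ) : ℝ) := by
      have h1 : K < K / d * d + d := Nat.lt_div_mul_add hd0
      have h2 : (K : ℝ) < ((K / d : ℕ) : ℝ) * d + d := by exact_mod_cast h1
      rw [div_sub_one hd0'.ne', div_le_iff₀ hd0']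
      linarith
    have hf := fq_nonneg q d
    calc (K : ℝ) * gq q d - fq 1 d ≤ (K : ℝ) * gq q d - fq q d := by linarith [fq_le_fq_one q d]
      _ = fq q d * ((K : ℝ) / d - 1) := by rw [gq_apply]; field_simp
      _ ≤ fq q d * ((K / d : ℕ) : ℝ) := mul_le_mul_of_nonneg_left hfloor hf
  have hsum := sum_le_sum hterm
  rw [sum_sub_distrib, ← mul_sum] at hsum
  -- `∑_{d ≤ K} f_1(d) ≤ y S_1 + K T(y+1)`
  have hf1 : ∑ d ∈ Ioc 0 K, fq 1 d ≤ y * sq 1 + K * tail (y + 1) := by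
    rw [← sum_Ioc_consecutive _ (Nat.zero_le y) hyK]
    have hA : ∑ d ∈ Ioc 0 y, fq 1 d ≤ y * sq 1 := by
      calc ∑ d ∈ Ioc 0 y, fq 1 d ≤ ∑ d ∈ Ioc 0 y, (y : ℝ) * gq 1 d := by
            refine sum_le_sum fun d hd ↦ ?_
            have hd' := mem_Ioc.1 hd
            have hd0 : (0 : ℝ) < d := by exact_mod_cast hd'.1
            have hdy : (d : ℝ) ≤ y := by exact_mod_cast hd'.2
            rw [gq_apply, mul_div_assoc']
            rw [le_div_iff₀ hd0]
            exact mul_le_mul_of_nonneg_left hdy (fq_nonneg 1 d) |>.trans_eq (mul_comm _ _)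
        _ = y * ∑ d ∈ Ioc 0 y, gq 1 d := by rw [mul_sum]
        _ ≤ y * sq 1 := mul_le_mul_of_nonneg_left (sum_gq_le_sq 1 y) (Nat.cast_nonneg y)
    have hB : ∑ d ∈ Ioc y K, fq 1 d ≤ K * tail (y + 1) := by
      calc ∑ d ∈ Ioc y K, fq 1 d ≤ ∑ d ∈ Ioc y K, (K : ℝ) * gq 1 d := by
            refine sum_le_sum fun d hd ↦ ?_
            have hd' := mem_Ioc.1 hd
            have hd0 : (0 : ℝ) < d := by exact_mod_cast (lt_of_le_of_lt (Nat.zero_le y) hd'.1)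
            have hdK : (d : ℝ) ≤ K := by exact_mod_cast hd'.2
            rw [gq_apply, mul_div_assoc', le_div_iff₀ hd0]
            exact mul_le_mul_of_nonneg_left hdK (fq_nonneg 1 d) |>.trans_eq (mul_comm _ _)
        _ = K * ∑ d ∈ Ioc y K, gq 1 d := by rw [mul_sum]
        _ ≤ K * tail (y + 1) :=
            mul_le_mul_of_nonneg_left (sum_Ioc_gq_one_le_tail hyK) (Nat.cast_nonneg K)
    linarith
  have hg := sq_sub_tail_le_sum q K
  have hK : (0 : ℝ) ≤ K := Nat.cast_nonneg K
  nlinarith [mul_le_mul_of_nonneg_left hg hK]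

/-- **Lower bound, uniform in `q`** (qualitative form of GS21 (desired)): for every `η > 0` there
is `K₀` such that `∑_{k ≤ K} H_q(k) ≥ K (S_q − η)` for all `K ≥ K₀` and all `q`.
[cite: GoldstonSuriajaya2021, §6 (desired)] -/
theorem sum_Hq_ge {η : ℝ} (hη : 0 < η) :
    ∃ K₀ : ℕ, ∀ K : ℕ, K₀ ≤ K → ∀ q : ℕ, K * (sq q - η) ≤ ∑ k ∈ Ioc 0 K, Hq q k := by
  have hη3 : 0 < η / 3 := by positivity
  obtain ⟨y, hy⟩ : ∃ y : ℕ, ∀ m, y ≤ m → tail m ≤ η / 3 := by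
    have := (tendsto_order.1 tendsto_tail).2 (η / 3) hη3
    obtain ⟨y, hy⟩ := eventually_atTop.1 this
    exact ⟨y, fun m hm ↦ (hy m hm).le⟩
  have hs1 : 0 ≤ sq 1 := le_trans zero_le_one (one_le_sq 1)
  refine ⟨max y ⌈3 * y * sq 1 / η⌉₊, fun K hK q ↦ ?_⟩
  have hyK : y ≤ K := le_trans (le_max_left _ _) hK
  have hK2 : 3 * y * sq 1 / η ≤ K := le_trans (Nat.le_ceil _) (by exact_mod_cast le_trans (le_max_right _ _) hK)
  have h := sum_Hq_ge_explicit q hyK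
  have hT1 : tail (K + 1) ≤ η / 3 := hy _ (by omega)
  have hT2 : tail (y + 1) ≤ η / 3 := hy _ (by omega)
  have hK0 : (0 : ℝ) ≤ K := Nat.cast_nonneg K
  have hy3 : (y : ℝ) * sq 1 ≤ K * (η / 3) := by
    rw [div_le_iff₀ hη] at hK2
    linarith
  nlinarith

/-! ### The mean value of `𝔖` over the multiples of `q` -/

/-- `∑_{k ≤ K, k even} F(k) = ∑_{j ≤ K/2} F(2j)`. [folklore] -/
theorem sum_Ioc_filter_even_eq (F : ℕ → ℝ) (K : ℕ) :
    ∑ k ∈ (Ioc 0 K).filter Even, F k = ∑ j ∈ Ioc 0 (K / 2), F (2 * j) := by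
  have hinj : Set.InjOn (fun j : ℕ ↦ 2 * j) (Ioc 0 (K / 2) : Finset ℕ) :=
    fun a _ b _ h ↦ by simpa using h
  rw [← sum_image hinj]
  refine sum_congr ?_ fun _ _ ↦ rfl
  ext k
  simp only [mem_filter, mem_Ioc, mem_image]
  constructor
  · rintro ⟨⟨hk0, hkK⟩, ⟨j, rfl⟩⟩
    refine ⟨j, ⟨by omega, ?_⟩, by ring⟩
    rw [Nat.le_div_iff_mul_le two_pos]
    omega
  · rintro ⟨j, ⟨hj0, hjK⟩, rfl⟩
    have := (Nat.le_div_iff_mul_le two_pos).1 hjK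
    exact ⟨⟨by omega, by omega⟩, even_two_mul j⟩

/-- `𝔖(n) ≥ 0`. [folklore] -/
theorem goldbachSingularSeries_nonneg (n : ℕ) : 0 ≤ goldbachSingularSeries n := by
  rw [goldbachSingularSeries]
  split_ifs
  · exact le_rfl
  · have := twinPrimeConst_pos_holds
    have h1 := one_le_hFactor n
    rw [hFactor] at h1
    have : (0 : ℝ) ≤ ∏ p ∈ n.primeFactors.filter (2 < ·), (((p : ℝ) - 1) / ((p : ℝ) - 2)) := by linarith
    rw [twinPrimeConst_pos] at *
    positivity

/-- **GS21 Lemma 1, upper half (Montgomery), uniform and without error term**: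
`G_q(K) = ∑_{k ≤ K} 𝔖(qk) ≤ (q/φ(q)) K` for all `q ≥ 1`, `K ≥ 0`.
[cite: GoldstonSuriajaya2021, Lemma 1 (lem1)] -/
theorem sum_goldbachSingularSeries_mul_le {q : ℕ} (hq : q ≠ 0) (K : ℕ) :
    ∑ k ∈ Ioc 0 K, goldbachSingularSeries (q * k) ≤ (q : ℝ) / (Nat.totient q : ℝ) * K := by
  have hmain := two_mul_twinPrimeConst_mul_hFactor_mul_sq hq
  have hC : 0 ≤ 2 * twinPrimeConst * hFactor q := by
    have h1 := one_le_hFactor q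
    have h2 := twinPrimeConst_pos_holds
    rw [twinPrimeConst_pos] at h2
    positivity
  have hφ : 0 ≤ (q : ℝ) / (Nat.totient q : ℝ) := by positivity
  by_cases he : Even q
  · rw [if_pos he, mul_one] at hmain
    calc ∑ k ∈ Ioc 0 K, goldbachSingularSeries (q * k)
        = ∑ k ∈ Ioc 0 K, 2 * twinPrimeConst * hFactor q * Hq q k := by
          refine sum_congr rfl fun k hk ↦ ?_
          rw [goldbachSingularSeries_mul hq (mem_Ioc.1 hk).1.ne', if_pos (he.mul_right k)]
      _ = 2 * twinPrimeConst * hFactor q * ∑ k ∈ Ioc 0 K, Hq q k := by rw [mul_sum]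
      _ ≤ 2 * twinPrimeConst * hFactor q * (K * sq q) :=
          mul_le_mul_of_nonneg_left (sum_Hq_le q K) hC
      _ = (q : ℝ) / (Nat.totient q : ℝ) * K := by rw [← hmain]; ring
  · rw [if_neg he] at hmain
    have hodd : Odd q := Nat.not_even_iff_odd.1 he
    calc ∑ k ∈ Ioc 0 K, goldbachSingularSeries (q * k)
        = ∑ k ∈ Ioc 0 K, if Even k then 2 * twinPrimeConst * hFactor q * Hq q k else 0 := by
          refine sum_congr rfl fun k hk ↦ ?_
          rw [goldbachSingularSeries_mul hq (mem_Ioc.1 hk).1.ne']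
          have : Even (q * k) ↔ Even k := by
            rw [Nat.even_mul]
            exact ⟨fun h ↦ h.resolve_left he, Or.inr⟩
          simp only [this]
      _ = 2 * twinPrimeConst * hFactor q * ∑ j ∈ Ioc 0 (K / 2), Hq q j := by
          rw [← sum_filter, sum_Ioc_filter_even_eq, mul_sum]
          refine sum_congr rfl fun j hj ↦ ?_
          rw [Hq_two_mul q (mem_Ioc.1 hj).1.ne']
      _ ≤ 2 * twinPrimeConst * hFactor q * ((K / 2 : ℕ) * sq q) :=
          mul_le_mul_of_nonneg_left (sum_Hq_le q (K / 2)) hC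
      _ = (q : ℝ) / (Nat.totient q : ℝ) * (2 * ((K / 2 : ℕ) : ℝ)) := by
          rw [show 2 * twinPrimeConst * hFactor q * (((K / 2 : ℕ) : ℝ) * sq q) =
            (2 * twinPrimeConst * hFactor q * sq q) * ((K / 2 : ℕ) : ℝ) by ring, hmain]
          ring
      _ ≤ (q : ℝ) / (Nat.totient q : ℝ) * K := by
          refine mul_le_mul_of_nonneg_left ?_ hφ
          have : 2 * (K / 2) ≤ K := Nat.mul_div_le K 2
          exact_mod_cast this

/-- **GS21 Lemma 1, lower half (Montgomery), qualitative and uniform in `q`**: for every `η > 0`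
there is `K₀` such that `G_q(K) = ∑_{k ≤ K} 𝔖(qk) ≥ (1 − η) (q/φ(q)) (K − 1)` for all `K ≥ K₀`
and all `q ≥ 1`. (The printed Lemma 1 has the error term `O((q/φ(q)) log 2K)`; only this `o(K)`
form, which needs no Mertens-type estimate, is proved here.) [cite: GoldstonSuriajaya2021, Lemma 1 (lem1)] -/
theorem sum_goldbachSingularSeries_mul_ge {η : ℝ} (hη : 0 < η) :
    ∃ K₀ : ℕ, ∀ K : ℕ, K₀ ≤ K → ∀ q : ℕ, q ≠ 0 →
      (1 - η) * ((q : ℝ) / (Nat.totient q : ℝ)) * ((K : ℝ) - 1) ≤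
        ∑ k ∈ Ioc 0 K, goldbachSingularSeries (q * k) := by
  obtain ⟨K₁, hK₁⟩ := sum_Hq_ge hη
  refine ⟨2 * K₁ + 2, fun K hK q hq ↦ ?_⟩
  have hsum0 : 0 ≤ ∑ k ∈ Ioc 0 K, goldbachSingularSeries (q * k) :=
    sum_nonneg fun k _ ↦ goldbachSingularSeries_nonneg _
  have hφ : 0 ≤ (q : ℝ) / (Nat.totient q : ℝ) := by positivity
  have hK1 : (1 : ℝ) ≤ K := by exact_mod_cast (show 1 ≤ K by omega)
  -- if `η ≥ 1` the bound is trivial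
  rcases le_or_gt 1 η with hη1 | hη1
  · have : (1 - η) * ((q : ℝ) / (Nat.totient q : ℝ)) * ((K : ℝ) - 1) ≤ 0 := by
      have h1 : (1 - η) * ((q : ℝ) / (Nat.totient q : ℝ)) ≤ 0 :=
        mul_nonpos_of_nonpos_of_nonneg (by linarith) hφ
      exact mul_nonpos_of_nonpos_of_nonneg h1 (by linarith)
    linarith
  have hmain := two_mul_twinPrimeConst_mul_hFactor_mul_sq hq
  have hC : 0 ≤ 2 * twinPrimeConst * hFactor q := by
    have h1 := one_le_hFactor q
    have h2 := twinPrimeConst_pos_holds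
    rw [twinPrimeConst_pos] at h2
    positivity
  have hsq1 := one_le_sq q
  -- `S_q − η ≥ (1 − η) S_q ≥ 0`
  have hsqη : (1 - η) * sq q ≤ sq q - η := by nlinarith
  by_cases he : Even q
  · rw [if_pos he, mul_one] at hmain
    have hKK : K₁ ≤ K := by omega
    have h1 := hK₁ K hKK q
    calc (1 - η) * ((q : ℝ) / (Nat.totient q : ℝ)) * ((K : ℝ) - 1)
        ≤ (1 - η) * ((q : ℝ) / (Nat.totient q : ℝ)) * K := by
          refine mul_le_mul_of_nonneg_left (by linarith) (mul_nonneg (by linarith) hφ)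
      _ = 2 * twinPrimeConst * hFactor q * (K * ((1 - η) * sq q)) := by rw [← hmain]; ring
      _ ≤ 2 * twinPrimeConst * hFactor q * (K * (sq q - η)) := by
          refine mul_le_mul_of_nonneg_left (mul_le_mul_of_nonneg_left hsqη (by linarith)) hC
      _ ≤ 2 * twinPrimeConst * hFactor q * ∑ k ∈ Ioc 0 K, Hq q k := mul_le_mul_of_nonneg_left h1 hC
      _ = ∑ k ∈ Ioc 0 K, goldbachSingularSeries (q * k) := by
          rw [mul_sum]
          refine sum_congr rfl fun k hk ↦ ?_
          rw [goldbachSingularSeries_mul hq (mem_Ioc.1 hk).1.ne', if_pos (he.mul_right k)]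
  · rw [if_neg he] at hmain
    have hKK : K₁ ≤ K / 2 := by omega
    have h1 := hK₁ (K / 2) hKK q
    have hK2 : (K : ℝ) - 1 ≤ 2 * ((K / 2 : ℕ) : ℝ) := by
      have : K ≤ 2 * (K / 2) + 1 := by omega
      have : (K : ℝ) ≤ 2 * ((K / 2 : ℕ) : ℝ) + 1 := by exact_mod_cast this
      linarith
    calc (1 - η) * ((q : ℝ) / (Nat.totient q : ℝ)) * ((K : ℝ) - 1)
        ≤ (1 - η) * ((q : ℝ) / (Nat.totient q : ℝ)) * (2 * ((K / 2 : ℕ) : ℝ)) :=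
          mul_le_mul_of_nonneg_left hK2 (mul_nonneg (by linarith) hφ)
      _ = 2 * twinPrimeConst * hFactor q * (((K / 2 : ℕ) : ℝ) * ((1 - η) * sq q)) := by
          rw [show (1 - η) * ((q : ℝ) / (Nat.totient q : ℝ)) * (2 * ((K / 2 : ℕ) : ℝ)) =
            ((q : ℝ) / (Nat.totient q : ℝ) * 2) * (((K / 2 : ℕ) : ℝ) * (1 - η)) by ring, ← hmain]
          ring
      _ ≤ 2 * twinPrimeConst * hFactor q * (((K / 2 : ℕ) : ℝ) * (sq q - η)) :=
          mul_le_mul_of_nonneg_left (mul_le_mul_of_nonneg_left hsqη (Nat.cast_nonneg _)) hC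
      _ ≤ 2 * twinPrimeConst * hFactor q * ∑ j ∈ Ioc 0 (K / 2), Hq q j :=
          mul_le_mul_of_nonneg_left h1 hC
      _ = ∑ k ∈ Ioc 0 K, goldbachSingularSeries (q * k) := by
          rw [mul_sum]
          symm
          calc ∑ k ∈ Ioc 0 K, goldbachSingularSeries (q * k)
              = ∑ k ∈ Ioc 0 K, if Even k then 2 * twinPrimeConst * hFactor q * Hq q k else 0 := by
                refine sum_congr rfl fun k hk ↦ ?_
                rw [goldbachSingularSeries_mul hq (mem_Ioc.1 hk).1.ne']
                have : Even (q * k) ↔ Even k := by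
                  rw [Nat.even_mul]
                  exact ⟨fun h ↦ h.resolve_left he, Or.inr⟩
                simp only [this]
            _ = ∑ j ∈ Ioc 0 (K / 2), 2 * twinPrimeConst * hFactor q * Hq q j := by
                rw [← sum_filter, sum_Ioc_filter_even_eq]
                refine sum_congr rfl fun j hj ↦ ?_
                rw [Hq_two_mul q (mem_Ioc.1 hj).1.ne']

end SingularSeriesMean

end Literature.NumberTheory.Sieve
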